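import Literature.MathematicalPhysics.QuantumFieldTheory.Balaban1983to89.T4HistoryLipschitzSegment
import Summits.QuantumFields.BalabanUV.T4Continuum.Support.NE9CouplingTwoPoint

/-!
# NE9LastCouplingBridge — the displayed binder (L) `LastCouplingLipschitz` of the NE9-P2 end-to-end theorem DERIVED from
two-point data in the last coupling at the ACTIVITY level (the currency of `NE9CouplingTwoPoint`), and the lineage's
END-TO-END `NE9 ∧ FadingMemory` with NO holomorphy-in-the-coupling binder left (cell `pub-balaban`, T4-DAG §2 node U3 /
§6 NE9; lineage t4-ne9-p1 = prover P1, generation 18; answers Q-g18-2 of `t4/T4-EST-NE9-P1.md` §25.6)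

HONEST FRAMING (T4-DAG PAGE 1).  Rung (B)+1 on a FIXED finite torus with `FlowStep.BetaPertH` and (B) explicit — NOT infinite
volume, NOT a mass gap, NOT the Clay problem.  NE9 (`T4OutputRate.NE9` ∧ `FadingMemory`) is a cell NEW ESTIMATE, NOT PRINTED,
and is NOT discharged here: every theorem below is bookkeeping over the ABSTRACT carriers of `T4OutputRate` and the abstract
cluster geometry of `T4HistoryLipschitzActivity.ClusterGeom` (the tree's kernel-proved Kotecký–Preiss layer underneath);
every analytic input is a DISPLAYED binder.  [I] = [Balaban1987RG1], [II] = [Balaban1988RG2Cluster] are quoted for TYPES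
only (ABSOLUTE RULE).  BetaPertH, (B), (B^μ) do not occur (they live in the window `W` of whoever instantiates).

WHERE THIS SITS.  The NE9-P2 lineage's end-to-end theorems (`T4HistoryLipschitzSegment.ne9_and_fadingMemory_of_twoPointKP_perStep`,
…, `T4HistoryLipschitzLinearSize.torus_ne9_and_fadingMemory_of_linSizeDecay`) display, besides printed-STRUCTURE binders,
majorants of Lemma-3 type and scalars, ONE binder of merely qualitative printed type in THIS lane's variable: (L)
`LastCouplingLipschitz E W T Ψ κ lam` — a Lipschitz MODULUS of the new term in its last coupling ([I] p. 263 «It is a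
C^∞-function of g_{j−1} ∈ [0, γ], (or analytic)», no modulus printed).  P2 derived it only from `HoloInLastCoupling`
(holomorphy in a COMPLEX coupling with a uniform margin — unavailable for the ε₁ cut-off, record §2 (L2)).  The sibling leaf
`NE9CouplingTwoPoint` proved the last-coupling two-point bound of the (2.14)-FORM activities with a REAL coupling (tables
dilated [S1-c], exponential by the segment bound, cut-off SHELL displayed).  THIS LEAF closes the plumbing: from TWO-POINT
DATA IN THE COUPLING AT THE ACTIVITY LEVEL (hypothesis COUPLING TWO-POINT, the coupling twin of P2's `TwoPointKP` Lipschitz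
clause), the CHANNEL's coupling modulus (hypothesis CHANNEL COUPLING MODULUS: the curly bracket of [I] (2.12) read at two shift
amplitudes — generation 17's `NE9FluctuationStep` channel «`LipBackground` × shift amplitude») and the EXPLICIT part's
coupling modulus, the binder (L) FOLLOWS by two triangle inequalities and the tree's pinned activity-Lipschitz engine
(`T4ActivityLipschitz.norm_clusterSum_sub_le_of_majorant`, through P2's `norm_newTerm_sub_le_of_twoPointKP`) — and with it
the lineage's END-TO-END statement `NE9 ∧ FadingMemory` whose displayed analytic inputs are ALL of one kind: configuration-free
MAJORANTS at occurring couplings (the TYPE of [II] (2.15)→(2.26)→(2.38), PROOF-INTERIOR of (B)) and two-point clauses under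
them, plus scalars.  No complex coupling, no radius, no margin anywhere.

WHAT IS PROVED (kernel, `[folklore]` bookkeeping).
§1 the two displayed hypotheses COUPLING TWO-POINT (coupling twin of `TwoPointKP`'s Lipschitz clause, with CROSS-UNIFORMITY
   of the majorant over the occurring couplings — printed TYPE: (2.38) is uniform in the coupling of the window) and CHANNEL
   COUPLING MODULUS — stated INLINE (no Prop-valued definition under `Summits/`).
§2 `norm_newTerm_sub_le_of_couplingTwoPoint`: `‖newTerm(g_k, Q) − newTerm(g′_k, Q)‖ ≤ 4·clip_k·|g_k − g′_k|·a(pin X)·e^{−δ(X)}`.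
§3 **`lastCouplingLipschitz_of_couplingTwoPoint`**: `LastCouplingLipschitz E W T Ψ κ (fun k => 4·clip k·B₀ k + pex k +
   4·lip k·B₀ k·qT k)`.
§4 **`ne9_and_fadingMemory_of_couplingTwoPoint`**: P2's `ne9_and_fadingMemory_of_twoPointKP_perStep` with (L) REPLACED by
   §1's binders + the explicit part's modulus; moduli `prodModuli ℓ (ω + 4·lipbar·B·τ̄)` with
   `ℓ = 4·clipbar·B + pexbar + 4·lipbar·B·qTbar`.
§5 (v1.1) `norm_formAct_sub_formAct_le_tCurrency`: the sibling's activity-level two-point bound with the dilation margin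
   `c·min(s, s′)` on the window `]0, γ]`, `≤ ((4m₁/c)(γ²/2) + σγ/2)·|s⁻² − s′⁻²|` — linear in `t = g⁻²` with a coupling-free
   constant: the shape of the `hCup` clause with histories written in `t`.
v1.1 (same seat; APPEND-ONLY over v1 p201771, every v1 declaration byte-identical): §5 added.
CURRENCY.  The coordinate `g k` of a history is whatever currency the instantiator chooses; in the coupling itself the
activity-level moduli of `NE9CouplingTwoPoint` are `|s − s′|/min(s, s′)` and `|s⁻¹ − s′⁻¹|`, bounded per unit of `t = g⁻²`
on `]0, γ]` (`NE9FluctuationStep.inv_min_mul_abs_sub_le`, `NE9CutoffShell.inv_sub_inv_le`), so COUPLING TWO-POINT with a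
constant `clip k` is the t-currency reading (`T4CurrencyMatching`, `T4CouplingAnalyticity.ne9_tCoord_of_ne9`).

References (TYPES only): [Balaban1987RG1] CMP 109 (1987) p. 263, (2.12)–(2.13) p. 268; [Balaban1988RG2Cluster] CMP 116 (1988)
(2.13)–(2.15) pp. 14–15, Lemma 3 (2.38) p. 20, (2.40)–(2.41) p. 21; [KoteckyPreiss1986] CMP 103 (1986) 491–498 (the engine,
tree-proved).
-/

noncomputable section

namespace Summit.QuantumFields.BalabanUV.T4Continuum.NE9LastCouplingBridge

open scoped BigOperators
open Literature.Probability.LatticeModels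
open Literature.MathematicalPhysics.QuantumFieldTheory.Balaban1983to89
open Literature.MathematicalPhysics.QuantumFieldTheory.Balaban1983to89.T4OutputRate
open Literature.MathematicalPhysics.QuantumFieldTheory.Balaban1983to89.T4ActivityLipschitz
open Literature.MathematicalPhysics.QuantumFieldTheory.Balaban1983to89.T4HistoryLipschitzRecursion
open Literature.MathematicalPhysics.QuantumFieldTheory.Balaban1983to89.T4HistoryLipschitzOuter
open Literature.MathematicalPhysics.QuantumFieldTheory.Balaban1983to89.T4HistoryLipschitzActivity
open Literature.MathematicalPhysics.QuantumFieldTheory.Balaban1983to89.T4HistoryLipschitzActivity (ClusterGeom)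
open Literature.MathematicalPhysics.QuantumFieldTheory.Balaban1983to89.T4HistoryLipschitzSegment

variable {C : Carriers} (G : ClusterGeom C) {Bg : Type} {Pot : Type*} [NormedAddCommGroup Pot]

/-! ## §1 The two displayed hypotheses of the coupling channel (stated INLINE in §2–§4; no Prop-valued definition is
introduced under `Summits/`, per the placement rule)

**COUPLING TWO-POINT** (`hCup` below; HYPOTHESIS, asserted nowhere): the coupling twin of the Lipschitz clause of P2's
`TwoPointKP`.  On the window `W`, for two histories `g, g′`, at step `k`, background `U`, scale-(k+1) domain `X`, for every
ADMISSIBLE configuration `Q ∈ 𝒜 k` and every polymer of the step volume: (cross-uniformity) the activity at coupling `g k` is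
bounded by the configuration-free majorant taken at the coupling `g′ k` — printed TYPE: the (2.38) majorant
«C₃ε₁ exp(−(1 − 8δ)½Lκd_{k+1}(Z))» of [II] p. 20 is UNIFORM over the window of couplings — and (two-point) the difference of the
activities at the two couplings is at most `clip k·|g k − g′ k|` times that majorant, `clip k ≥ 0`.  Instantiated polymer by
polymer by `NE9CouplingTwoPoint.norm_formAct_le` / `norm_formAct_sub_formAct_le` ((E-hol) + (A″₁) + (SHELL)) in the currency in
which those moduli are constants (`t = g⁻²`).

**CHANNEL COUPLING MODULUS** (`hTcup` below; HYPOTHESIS, asserted nowhere): the step-k channel read at two coupling ARGUMENTS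
on the SAME old terms differs by at most `wt k y·qT k·|g k − g′ k|` at every output index, `qT k ≥ 0`.  Printed TYPE: the
curly bracket of [I] (2.12) p. 268 `{𝐄_k(U_k(exp i[g_kCB − hD̃(g_kCB)]V^{(k)})) − 𝐄_k(U_k(V^{(k)}))}` reads the coupling as the
AMPLITUDE of a background shift; its modulus in the amplitude is the old action's background-Lipschitz constant times the
shift per unit coupling (generation 17's `NE9FluctuationStep.FluctStep.abs_step_sub_step_le_of_lastCoupling`; [III]
(2.27)(ii) + Cauchy in the background) — or, at the table level, the dilation of
`NE9CouplingTwoPoint.norm_sub_le_of_holoOn_dilation`. -/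

/-! ## §2 The new term at two couplings, same configuration -/

/-- **THE COUPLING TWO-POINT BOUND OF THE NEW TERM (kernel)**: `TwoPointKP` (its uniform clause and KP for `2n` at the
coupling `g′ k`) ∧ COUPLING TWO-POINT (§1) ∧ decay extraction ⇒ for admissible `Q`,
`‖newTerm(g k, Q) − newTerm(g′ k, Q)‖ ≤ 4·(clip k·|g k − g′ k|)·a(pin X)·e^{−δ(X)}` — the tree's pinned activity-Lipschitz
theorem under the common majorant `n k (g′ k) U` (`T4ActivityLipschitz.norm_clusterSum_sub_le_of_majorant`).
[cite: Balaban1988RG2Cluster, (2.13)-(2.15) pp.14-15 and Lemma 3 (2.38) p.20; KoteckyPreiss1986, (1)-(4) p.492] -/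
theorem norm_newTerm_sub_le_of_couplingTwoPoint {W : Set (ℕ → ℝ)} {act : ℕ → ℝ → Bg → Pot → G.P → ℂ}
    {𝒜 : ℕ → Set Pot} {n : ℕ → ℝ → Bg → G.P → ℝ} {lip clip : ℕ → ℝ} {a d : G.P → ℝ}
    (hK : TwoPointKP G W act 𝒜 n lip a d) (hclip0 : ∀ k, 0 ≤ clip k)
    (hCup : ∀ g ∈ W, ∀ g' ∈ W, ∀ (k : ℕ) (U : Bg) (X : C.Dom), C.scale X = k + 1 → ∀ Q ∈ 𝒜 k, ∀ γ ∈ G.vol X,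
      ‖act k (g k) U Q γ‖ ≤ n k (g' k) U γ ∧
        ‖act k (g k) U Q γ - act k (g' k) U Q γ‖ ≤ clip k * |g k - g' k| * n k (g' k) U γ)
    {δ : C.Dom → ℝ} (hdec : G.DecayExtract δ d) {g g' : ℕ → ℝ} (hg : g ∈ W) (hg' : g' ∈ W) {k : ℕ} {U : Bg}
    {X : C.Dom} (hX : C.scale X = k + 1) {Q : Pot} (hQ : Q ∈ 𝒜 k) :
    ‖G.newTerm act k (g k) U X Q - G.newTerm act k (g' k) U X Q‖ ≤
      4 * (clip k * |g k - g' k|) * a (G.pin X) * Real.exp (-(δ X)) := by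
  obtain ⟨ha, hd, -, hP⟩ := hK
  obtain ⟨hbd', -, hkp'⟩ := hP g' hg' k U X hX
  have hcross := hCup g hg g' hg' k U X hX Q hQ
  exact norm_clusterSum_sub_le_of_majorant (inc := G.inc) ha hd (mul_nonneg (hclip0 k) (abs_nonneg _))
    (fun γ hγ => (hcross γ hγ).1) (fun γ hγ => hbd' Q hQ γ hγ) (fun γ hγ => (hcross γ hγ).2) hkp'
    (G.pin_mem X) (G.clus_sub X) (G.clus_pin X) (hdec X)

/-! ## §3 The binder (L) derived -/

/-- **`LastCouplingLipschitz` FROM COUPLING TWO-POINT DATA (the theorem of this leaf).**  Data, all displayed: the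
representation of the new term as «real part of the localized cluster sum read at `ρ k P`» PLUS a configuration-free
explicit part `expl k s U X` (this implies P2's `hΨ`; printed STRUCTURE: [II] p. 21 adds «[log Z^{(k)}(U_{k+1}) − log Z^{(k)}(1)]»
and the 𝐏^{(k)}-only contributions to the cluster expansion in the old tables); `TwoPointKP` (P2) and COUPLING TWO-POINT (§1 `hCup`)
under the same majorant; decay extraction and the pin budget (P2); the reading `ρ` dominated by the weighted majorant (P2);
admissibility of every occurring configuration `ρ k (T k g′ (E g))`, `g, g′ ∈ W` (P2's `hocc`, DERIVED in P2's §9 size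
induction); the channel's coupling modulus `qT` (§1 `hTcup`) and the explicit part's coupling modulus `pex`.  Then
`LastCouplingLipschitz E W T Ψ κ (fun k => 4·clip k·B₀ k + pex k + 4·lip k·B₀ k·qT k)`: split
`Ψ k (g k) (T k g (E g)) − Ψ k (g′ k) (T k g′ (E g))` at `Ψ k (g′ k) (T k g (E g))`; the first difference is §2 + the
explicit part, the second is P2's `norm_newTerm_sub_le_of_twoPointKP` at coupling `g′ k` between the two occurring
configurations, whose distance is `≤ qT k·|g k − g′ k|` by `hTcup` and `hρ`.
[cite: Balaban1987RG1, p.263 (1.18) and (2.12)-(2.13) p.268; Balaban1988RG2Cluster, (2.40)-(2.41) p.21] -/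
theorem lastCouplingLipschitz_of_couplingTwoPoint {ι : Type} {E : Functional C Bg} {W : Set (ℕ → ℝ)}
    {T : ℕ → (ℕ → ℝ) → (Bg → C.Dom → ℝ) → ι → ℝ} {Ψ : ℕ → ℝ → (ι → ℝ) → Bg → C.Dom → ℝ}
    {act : ℕ → ℝ → Bg → Pot → G.P → ℂ} {𝒜 : ℕ → Set Pot} {n : ℕ → ℝ → Bg → G.P → ℝ} {lip clip : ℕ → ℝ}
    {a d : G.P → ℝ} {δ : C.Dom → ℝ} {B₀ pex qT : ℕ → ℝ} {κ : ℝ} {wt : ℕ → ι → ℝ} (ρ : ℕ → (ι → ℝ) → Pot)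
    (expl : ℕ → ℝ → Bg → C.Dom → ℝ) (hK : TwoPointKP G W act 𝒜 n lip a d) (hclip0 : ∀ k, 0 ≤ clip k)
    (hCup : ∀ g ∈ W, ∀ g' ∈ W, ∀ (k : ℕ) (U : Bg) (X : C.Dom), C.scale X = k + 1 → ∀ Q ∈ 𝒜 k, ∀ γ ∈ G.vol X,
      ‖act k (g k) U Q γ‖ ≤ n k (g' k) U γ ∧
        ‖act k (g k) U Q γ - act k (g' k) U Q γ‖ ≤ clip k * |g k - g' k| * n k (g' k) U γ)
    (hdec : G.DecayExtract δ d) (hpin : G.PinBudget a δ B₀ κ)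
    (hρ : ∀ (k : ℕ) (P P' : ι → ℝ) (M : ℝ), (∀ y, |P y - P' y| ≤ wt k y * M) → ‖ρ k P - ρ k P'‖ ≤ M)
    (hrepr : ∀ (k : ℕ) (s : ℝ) (P : ι → ℝ) (U : Bg) (X : C.Dom),
      Ψ k s P U X = (G.newTerm act k s U X (ρ k P)).re + expl k s U X)
    (hexpl : ∀ g ∈ W, ∀ g' ∈ W, ∀ (k : ℕ) (U : Bg) (X : C.Dom), C.scale X = k + 1 →
      |expl k (g k) U X - expl k (g' k) U X| ≤ Real.exp (-(κ * C.d X)) * (pex k * |g k - g' k|))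
    (hqT0 : ∀ k, 0 ≤ qT k)
    (hTcup : ∀ g ∈ W, ∀ g' ∈ W, ∀ (k : ℕ) (y : ι), |T k g (E g) y - T k g' (E g) y| ≤ wt k y * (qT k * |g k - g' k|))
    (hocc : ∀ g ∈ W, ∀ g' ∈ W, ∀ k : ℕ, ρ k (T k g' (E g)) ∈ 𝒜 k) :
    LastCouplingLipschitz E W T Ψ κ (fun k => 4 * clip k * B₀ k + pex k + 4 * lip k * B₀ k * qT k) := by
  intro g hg g' hg' k U X hX
  set P : ι → ℝ := T k g (E g)
  set P' : ι → ℝ := T k g' (E g)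
  have hQ : ρ k P ∈ 𝒜 k := hocc g hg g hg k
  have hQ' : ρ k P' ∈ 𝒜 k := hocc g hg g' hg' k
  have ha0 : 0 ≤ a (G.pin X) := hK.1 _
  have hlip0 : 0 ≤ lip k := hK.2.2.1 k
  have hclip0k : 0 ≤ clip k := hclip0 k
  have hqT0k : 0 ≤ qT k := hqT0 k
  have henv := hpin k X hX
  have hΔ : 0 ≤ |g k - g' k| := abs_nonneg _
  -- (i) same configuration, two couplings: §2 + explicit part
  have h1 : |Ψ k (g k) P U X - Ψ k (g' k) P U X| ≤
      Real.exp (-(κ * C.d X)) * ((4 * clip k * B₀ k + pex k) * |g k - g' k|) := by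
    rw [hrepr k (g k) P U X, hrepr k (g' k) P U X]
    have hnt := norm_newTerm_sub_le_of_couplingTwoPoint G hK hclip0 hCup hdec hg hg' hX (U := U) hQ
    have hre : |(G.newTerm act k (g k) U X (ρ k P)).re - (G.newTerm act k (g' k) U X (ρ k P)).re| ≤
        4 * (clip k * |g k - g' k|) * a (G.pin X) * Real.exp (-(δ X)) := by
      rw [← Complex.sub_re]
      exact (Complex.abs_re_le_norm _).trans hnt
    have hex := hexpl g hg g' hg' k U X hX
    calc |(G.newTerm act k (g k) U X (ρ k P)).re + expl k (g k) U X -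
            ((G.newTerm act k (g' k) U X (ρ k P)).re + expl k (g' k) U X)|
        = |((G.newTerm act k (g k) U X (ρ k P)).re - (G.newTerm act k (g' k) U X (ρ k P)).re) +
            (expl k (g k) U X - expl k (g' k) U X)| := by ring_nf
      _ ≤ |(G.newTerm act k (g k) U X (ρ k P)).re - (G.newTerm act k (g' k) U X (ρ k P)).re| +
            |expl k (g k) U X - expl k (g' k) U X| := abs_add_le _ _
      _ ≤ 4 * (clip k * |g k - g' k|) * a (G.pin X) * Real.exp (-(δ X)) +
            Real.exp (-(κ * C.d X)) * (pex k * |g k - g' k|) := add_le_add hre hex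
      _ = 4 * clip k * |g k - g' k| * (a (G.pin X) * Real.exp (-(δ X))) +
            Real.exp (-(κ * C.d X)) * (pex k * |g k - g' k|) := by ring
      _ ≤ 4 * clip k * |g k - g' k| * (B₀ k * Real.exp (-(κ * C.d X))) +
            Real.exp (-(κ * C.d X)) * (pex k * |g k - g' k|) :=
          add_le_add (mul_le_mul_of_nonneg_left henv (by positivity)) le_rfl
      _ = Real.exp (-(κ * C.d X)) * ((4 * clip k * B₀ k + pex k) * |g k - g' k|) := by ring
  -- (ii) same coupling g′ k, two occurring configurations: P2's two-point bound
  have hdist : ‖ρ k P - ρ k P'‖ ≤ qT k * |g k - g' k| :=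
    hρ k P P' (qT k * |g k - g' k|) fun y => hTcup g hg g' hg' k y
  have h2 : |Ψ k (g' k) P U X - Ψ k (g' k) P' U X| ≤
      Real.exp (-(κ * C.d X)) * (4 * lip k * B₀ k * qT k * |g k - g' k|) := by
    rw [hrepr k (g' k) P U X, hrepr k (g' k) P' U X]
    have hnt := norm_newTerm_sub_le_of_twoPointKP G hK hdec hg' hX (U := U) hQ hQ'
    calc |(G.newTerm act k (g' k) U X (ρ k P)).re + expl k (g' k) U X -
            ((G.newTerm act k (g' k) U X (ρ k P')).re + expl k (g' k) U X)|
        = |(G.newTerm act k (g' k) U X (ρ k P) - G.newTerm act k (g' k) U X (ρ k P')).re| := by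
          rw [Complex.sub_re]; ring_nf
      _ ≤ ‖G.newTerm act k (g' k) U X (ρ k P) - G.newTerm act k (g' k) U X (ρ k P')‖ := Complex.abs_re_le_norm _
      _ ≤ 4 * (lip k * ‖ρ k P - ρ k P'‖) * a (G.pin X) * Real.exp (-(δ X)) := hnt
      _ = 4 * lip k * ‖ρ k P - ρ k P'‖ * (a (G.pin X) * Real.exp (-(δ X))) := by ring
      _ ≤ 4 * lip k * (qT k * |g k - g' k|) * (B₀ k * Real.exp (-(κ * C.d X))) :=
          mul_le_mul (mul_le_mul_of_nonneg_left hdist (by positivity)) henv (mul_nonneg ha0 (Real.exp_nonneg _))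
            (by positivity)
      _ = Real.exp (-(κ * C.d X)) * (4 * lip k * B₀ k * qT k * |g k - g' k|) := by ring
  calc |Ψ k (g k) P U X - Ψ k (g' k) P' U X|
      ≤ |Ψ k (g k) P U X - Ψ k (g' k) P U X| + |Ψ k (g' k) P U X - Ψ k (g' k) P' U X| := abs_sub_le _ _ _
    _ ≤ Real.exp (-(κ * C.d X)) * ((4 * clip k * B₀ k + pex k) * |g k - g' k|) +
          Real.exp (-(κ * C.d X)) * (4 * lip k * B₀ k * qT k * |g k - g' k|) := add_le_add h1 h2
    _ = Real.exp (-(κ * C.d X)) * ((4 * clip k * B₀ k + pex k + 4 * lip k * B₀ k * qT k) * |g k - g' k|) := by ring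

omit [NormedAddCommGroup Pot] in
/-- The representation «Re (cluster sum at `ρ k P`) + explicit part» implies P2's difference identity `hΨ`. [folklore] -/
theorem hΨ_of_repr {ι : Type} {Ψ : ℕ → ℝ → (ι → ℝ) → Bg → C.Dom → ℝ} {act : ℕ → ℝ → Bg → Pot → G.P → ℂ}
    (ρ : ℕ → (ι → ℝ) → Pot) (expl : ℕ → ℝ → Bg → C.Dom → ℝ)
    (hrepr : ∀ (k : ℕ) (s : ℝ) (P : ι → ℝ) (U : Bg) (X : C.Dom),
      Ψ k s P U X = (G.newTerm act k s U X (ρ k P)).re + expl k s U X)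
    (k : ℕ) (s : ℝ) (P P' : ι → ℝ) (U : Bg) (X : C.Dom) :
    Ψ k s P U X - Ψ k s P' U X = (G.newTerm act k s U X (ρ k P) - G.newTerm act k s U X (ρ k P')).re := by
  rw [hrepr, hrepr, Complex.sub_re]
  ring

/-! ## §4 END-TO-END: NE9 ∧ FADING MEMORY with no holomorphy-in-the-coupling binder -/

/-- **NE9 ∧ FADING MEMORY FROM TWO-POINT KP IN BOTH VARIABLES, every conditional by name** — P2's
`ne9_and_fadingMemory_of_twoPointKP_perStep` with its binder (L) `LastCouplingLipschitz` REPLACED by §1's COUPLING TWO-POINT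
(`hCup`) and CHANNEL COUPLING MODULUS (`hTcup`), the representation `hrepr`, and the explicit part's modulus; moduli
`Λ k i = ℓ·(ω + 4·lipbar·B·τ̄)^{k−1−i}` with `ℓ = 4·clipbar·B + pexbar + 4·lipbar·B·qTbar`, and the memory fades iff
`ω + 4·lipbar·B·τ̄ < 1` (P2's radius-free fading condition; NOT PRINTED as an inequality).  DISPLAYED after this leaf (the whole
list): printed-STRUCTURE binders `ScaleZeroFree`, `AdmissibleTerms`, `AdmRestrict`, `ChannelAdditive`, `ChannelStepSum`,
`Factorises`, `hrepr`; the per-step channel size bound `ChannelSizeAtStepNN` with its contraction profile `τ k j ≤ τ̄ω^{k−j}`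
([II] Lemma 1 (1.36) with the factor `L^jη` per creation step, SUPPORTED); `TwoPointKP` and `hCup` — ONE
configuration-free majorant at occurring couplings (TYPE (2.15)→(2.26)→(2.38), PROOF-INTERIOR of (B)) with the two two-point
clauses under it (table variable: segment bound; coupling variable: `NE9CouplingTwoPoint`); `DecayExtract` ((2.27)),
`PinBudget` ((2.40)→(2.41)); `hTcup` (shift-amplitude channel); the explicit part's modulus; the occupation
`hocc` (DERIVED in P2 §9 from the size induction); scalars.  Nothing about [I]/[II] asserted; 0/9 unchanged.
[cite: Balaban1987RG1, p.263 (1.18), (2.12)-(2.13) p.268; Balaban1988RG2Cluster, (1.36) p.9, (2.13)-(2.15) pp.14-15,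
Lemma 3 (2.38) p.20, (2.41) p.21; KoteckyPreiss1986, (1)-(4) p.492] -/
theorem ne9_and_fadingMemory_of_couplingTwoPoint [NormedSpace ℂ Pot] {ι : Type} {E : Functional C Bg}
    {W : Set (ℕ → ℝ)} {Adm : Set (Bg → C.Dom → ℝ)} {T : ℕ → (ℕ → ℝ) → (Bg → C.Dom → ℝ) → ι → ℝ}
    {Ψ : ℕ → ℝ → (ι → ℝ) → Bg → C.Dom → ℝ} {act : ℕ → ℝ → Bg → Pot → G.P → ℂ} {𝒜 : ℕ → Set Pot}
    {n : ℕ → ℝ → Bg → G.P → ℝ} {lip clip : ℕ → ℝ} {a d : G.P → ℝ} {δ : C.Dom → ℝ}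
    {κ B lipbar clipbar pexbar qTbar τbar ω : ℝ} {wt : ℕ → ι → ℝ} {τ : ℕ → ℕ → ℝ} {pex qT : ℕ → ℝ}
    (ρ : ℕ → (ι → ℝ) → Pot) (expl : ℕ → ℝ → Bg → C.Dom → ℝ) (h0 : ScaleZeroFree E W)
    (hAdm : AdmissibleTerms E W Adm) (hres : AdmRestrict Adm) (hadd : ChannelAdditive Adm T)
    (hsum : ChannelStepSum Adm T) (hstep : ChannelSizeAtStepNN Adm T κ wt τ) (hfac : Factorises E W T Ψ)
    -- the coupling channel (replaces `LastCouplingLipschitz`): COUPLING TWO-POINT and CHANNEL COUPLING MODULUS of §1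
    (hclip0 : ∀ k, 0 ≤ clip k)
    (hCup : ∀ g ∈ W, ∀ g' ∈ W, ∀ (k : ℕ) (U : Bg) (X : C.Dom), C.scale X = k + 1 → ∀ Q ∈ 𝒜 k, ∀ γ ∈ G.vol X,
      ‖act k (g k) U Q γ‖ ≤ n k (g' k) U γ ∧
        ‖act k (g k) U Q γ - act k (g' k) U Q γ‖ ≤ clip k * |g k - g' k| * n k (g' k) U γ)
    (hqT0 : ∀ k, 0 ≤ qT k)
    (hTcup : ∀ g ∈ W, ∀ g' ∈ W, ∀ (k : ℕ) (y : ι), |T k g (E g) y - T k g' (E g) y| ≤ wt k y * (qT k * |g k - g' k|))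
    (hrepr : ∀ (k : ℕ) (s : ℝ) (P : ι → ℝ) (U : Bg) (X : C.Dom),
      Ψ k s P U X = (G.newTerm act k s U X (ρ k P)).re + expl k s U X)
    (hexpl : ∀ g ∈ W, ∀ g' ∈ W, ∀ (k : ℕ) (U : Bg) (X : C.Dom), C.scale X = k + 1 →
      |expl k (g k) U X - expl k (g' k) U X| ≤ Real.exp (-(κ * C.d X)) * (pex k * |g k - g' k|))
    (hclipb : ∀ k, clip k ≤ clipbar) (hpexb : ∀ k, pex k ≤ pexbar) (hpexbar : 0 ≤ pexbar) (hqTb : ∀ k, qT k ≤ qTbar)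
    -- the table channel and the common data (P2)
    (hK : TwoPointKP G W act 𝒜 n lip a d) (hdec : G.DecayExtract δ d) (hpin : G.PinBudget a δ (fun _ => B) κ)
    (hρ : ∀ (k : ℕ) (P P' : ι → ℝ) (M : ℝ), (∀ y, |P y - P' y| ≤ wt k y * M) → ‖ρ k P - ρ k P'‖ ≤ M)
    (hocc : ∀ g ∈ W, ∀ g' ∈ W, ∀ k : ℕ, ρ k (T k g' (E g)) ∈ 𝒜 k) (hB : 0 ≤ B)
    (hlipb : ∀ k, lip k ≤ lipbar) (hτbar : 0 ≤ τbar) (hω : 0 ≤ ω) (hpos : 0 < ω + 4 * lipbar * B * τbar)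
    (hτ : ∀ k j, j ≤ k → 0 ≤ τ k j ∧ τ k j ≤ τbar * ω ^ (k - j)) :
    NE9 E W κ (prodModuli (4 * clipbar * B + pexbar + 4 * lipbar * B * qTbar) fun _ => ω + 4 * lipbar * B * τbar) ∧
      FadingMemory ((4 * clipbar * B + pexbar + 4 * lipbar * B * qTbar) / (ω + 4 * lipbar * B * τbar))
        (ω + 4 * lipbar * B * τbar)
        (prodModuli (4 * clipbar * B + pexbar + 4 * lipbar * B * qTbar) fun _ => ω + 4 * lipbar * B * τbar) := by
  have hlast := lastCouplingLipschitz_of_couplingTwoPoint G ρ expl hK hclip0 hCup hdec hpin hρ hrepr hexpl hqT0 hTcup hocc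
  have hlip0 : ∀ k, 0 ≤ lip k := hK.2.2.1
  have hclipbar : 0 ≤ clipbar := (hclip0 0).trans (hclipb 0)
  have hlipbar : 0 ≤ lipbar := (hlip0 0).trans (hlipb 0)
  have hqTbar : 0 ≤ qTbar := (hqT0 0).trans (hqTb 0)
  have hℓ : 0 ≤ 4 * clipbar * B + pexbar + 4 * lipbar * B * qTbar := by positivity
  have hlam : ∀ k, 4 * clip k * B + pex k + 4 * lip k * B * qT k ≤ 4 * clipbar * B + pexbar + 4 * lipbar * B * qTbar := by
    intro k
    have h1 : 4 * clip k * B ≤ 4 * clipbar * B := by gcongr; exact hclipb k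
    have h3 : 4 * lip k * B * qT k ≤ 4 * lipbar * B * qTbar := by
      have := hlipb k; have := hqTb k; have := hlip0 k; have := hqT0 k
      gcongr
    linarith [hpexb k]
  exact ne9_and_fadingMemory_of_twoPointKP_perStep G ρ h0 hAdm hres hadd hsum hstep hfac hlast hK hdec hpin hρ
    (hΨ_of_repr G ρ expl hrepr) hocc hℓ hB hlipb hτbar hω hpos hlam hτ

/-! ## §5 (v1.1) The activity-level bound of `NE9CouplingTwoPoint` in the currency `t = g⁻²` — the shape of §1's
COUPLING TWO-POINT clause -/

section TCurrency

open MeasureTheory Set Metric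
open scoped symmDiff
open Summit.QuantumFields.BalabanUV.T4Continuum.NE9CouplingTwoPoint

variable {Ω : Type*} [MeasurableSpace Ω]

/-- **THE TWO-POINT BOUND OF §1 IN THE CURRENCY `t = g⁻²`.**  For two couplings `s, s′` of the window `]0, γ]` and the
DILATION MARGIN `ϱ = c·min(s, s′)` (the (E-hol) discs of aperture `c` about the smaller coupling), the bound of
`norm_formAct_sub_formAct_le` reads `‖H_s(Z) − H_{s′}(Z)‖ ≤ ((4m₁/c)·(γ²/2) + σ·(γ/2))·|s⁻² − s′⁻²|` — a modulus LINEAR in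
the β-recursion's coordinate `t = g⁻²` ([I] (2.15) p. 268 «1/g_k² = 1/g²_{k+1} + β_{k+1}(g_k)») with a constant free of the
couplings: the inline COUPLING TWO-POINT hypothesis `hCup` of `lastCouplingLipschitz_of_couplingTwoPoint` (§3)
with `clip = ((4m₁/c)(γ²/2) + σγ/2)/n` per unit of the common majorant `n`, histories written in `t`.  Conversions:
generation 17's `NE9FluctuationStep.inv_min_mul_abs_sub_le` and `NE9CutoffShell.inv_sub_inv_le`.
[cite: Balaban1987RG1, (2.15) p.268 and Thm 1 p.259; Balaban1988RG2Cluster, (2.14)-(2.15) p.15] -/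
theorem norm_formAct_sub_formAct_le_tCurrency {μ : Measure Ω} {S : ℝ → Set Ω} {pre : Ω → ℂ} {V : ℝ → Ω → ℂ}
    {Vh : ℂ → Ω → ℂ} {D : Set ℂ} {e : Ω → ℝ} {γ c m₁ σ : ℝ} {s s' : ℝ}
    (hS : ∀ x, MeasurableSet (S x)) (hpre : AEStronglyMeasurable pre μ) (hV : ∀ x, AEStronglyMeasurable (V x) μ)
    (hint₀ : Integrable (fun ω => ‖pre ω‖ * Real.exp (e ω)) μ)
    (hint₁ : Integrable (fun ω => ‖pre ω‖ * e ω * Real.exp (e ω)) μ)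
    (hs : 0 < s) (hsγ : s ≤ γ) (hs' : 0 < s') (hs'γ : s' ≤ γ) (hc : 0 < c)
    -- (E-hol) on the dilation discs of aperture c about the smaller coupling, along the segment [min, max]
    (hhol : ∀ ω, DifferentiableOn ℂ (fun z => Vh z ω) D) (hbd : ∀ ω, ∀ z ∈ D, ‖Vh z ω‖ ≤ e ω)
    (hD : ∀ x ∈ Icc (min s s') (max s s'), closedBall (x : ℂ) (c * min s s') ⊆ D)
    (hres : ∀ x ∈ Icc (min s s') (max s s'), ∀ ω, V x ω = Vh (x : ℂ) ω)
    (hm₁0 : 0 ≤ m₁) (hσ0 : 0 ≤ σ)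
    (hm₁ : ∫ ω, (S s').indicator (fun ω => ‖pre ω‖ * e ω * Real.exp (e ω)) ω ∂μ ≤ m₁)
    (hshell : ∫ ω, (S s ∆ S s').indicator (fun ω => ‖pre ω‖ * Real.exp (e ω)) ω ∂μ ≤ σ * |s⁻¹ - s'⁻¹|) :
    ‖formAct μ S pre V s - formAct μ S pre V s'‖ ≤
      (4 * m₁ / c * (γ ^ 2 / 2) + σ * (γ / 2)) * |(s ^ 2)⁻¹ - (s' ^ 2)⁻¹| := by
  have hmin : 0 < min s s' := lt_min hs hs'
  have hϱ : 0 < c * min s s' := mul_pos hc hmin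
  have hsI : s ∈ Icc (min s s') (max s s') := ⟨min_le_left _ _, le_max_left _ _⟩
  have hs'I : s' ∈ Icc (min s s') (max s s') := ⟨min_le_right _ _, le_max_right _ _⟩
  have h := norm_formAct_sub_formAct_le hS hpre hV hint₀ hint₁ hϱ hhol hbd hD hres hsI hs'I hm₁ hshell
  have h1 : 4 * |s - s'| / (c * min s s') * m₁ ≤ 4 * m₁ / c * (γ ^ 2 / 2) * |(s ^ 2)⁻¹ - (s' ^ 2)⁻¹| := by
    have hconv := NE9FluctuationStep.inv_min_mul_abs_sub_le hs hsγ hs' hs'γ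
    have heq : 4 * |s - s'| / (c * min s s') * m₁ = 4 * m₁ / c * ((min s s')⁻¹ * |s - s'|) := by
      field_simp
    rw [heq, mul_assoc (4 * m₁ / c)]
    exact mul_le_mul_of_nonneg_left hconv (by positivity)
  have h2 : σ * |s⁻¹ - s'⁻¹| ≤ σ * (γ / 2) * |(s ^ 2)⁻¹ - (s' ^ 2)⁻¹| := by
    rw [mul_assoc]
    exact mul_le_mul_of_nonneg_left (NE9CutoffShell.inv_sub_inv_le hs hsγ hs' hs'γ) hσ0
  calc ‖formAct μ S pre V s - formAct μ S pre V s'‖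
      ≤ 4 * |s - s'| / (c * min s s') * m₁ + σ * |s⁻¹ - s'⁻¹| := h
    _ ≤ 4 * m₁ / c * (γ ^ 2 / 2) * |(s ^ 2)⁻¹ - (s' ^ 2)⁻¹| + σ * (γ / 2) * |(s ^ 2)⁻¹ - (s' ^ 2)⁻¹| :=
        add_le_add h1 h2
    _ = (4 * m₁ / c * (γ ^ 2 / 2) + σ * (γ / 2)) * |(s ^ 2)⁻¹ - (s' ^ 2)⁻¹| := by ring

end TCurrency

end Summit.QuantumFields.BalabanUV.T4Continuum.NE9LastCouplingBridge

end
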